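import Summits.PneNP.PneNP.Theses.RootDecompQuantumCell

/-! # Root decomposition N19 (QuantumCell) — the typed tests decided modulo the AIK22 Thm-4 binder

Closes the record aside stmt-PneNP-32933 `QTestsDecided` of route
`route-PneNP-RootDecompQuantumCell` rev 4 (decomp-pnenp cell; lens-4 g14 kernel
`qTestsDecided_holds`, critic CLEARED 2026-08-30T12:08:03Z, anchor 12:22:49Z; writer g8 landing
certificate `N19g14_landing-g8.lean`): the print binder «AIK22 Thm-4 world» (∃ B with
`NP^B ⊆ P^B` and languages `M ∈ BQP^B`, `L ∈ PP^B ∖ BQP^B` with `M ∈ P^B → L ∈ NP^B`) gives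
`TQC`, and together with `P^B ⊆ BQP^B` also `TQI`.

Pure logic over the binder; standard axioms only.
[cite: AaronsonIngramKretschmer2022, Thm. 4, Cor. 43–45]
-/

namespace Summit.PneNP.PneNP.Theorems

/-- `QTestsDecided`: the AIK22 Thm-4 binder decides `TQC`, and `TQI` given `∀ B, P^B ⊆ BQP^B`.
Closes stmt-PneNP-32933. -/
theorem qTestsDecided_proof :
    Summit.PneNP.PneNP.Theses.RootDecompQuantumCell.QTestsDecided := by
  unfold Summit.PneNP.PneNP.Theses.RootDecompQuantumCell.QTestsDecided
    Summit.PneNP.PneNP.Theses.RootDecompQuantumCell.TQC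
    Summit.PneNP.PneNP.Theses.RootDecompQuantumCell.TQI
  rintro ⟨B, hc, L, M, hM, hL, hLPP, hML⟩
  refine ⟨⟨B, hc, fun hPB => hL (hPB hLPP)⟩, fun hPBQ => ⟨B, hc, ?_, fun hPB => hL (hPB hLPP)⟩⟩
  intro hBP
  exact hL (hPBQ B (hc (hML (hBP hM))))

end Summit.PneNP.PneNP.Theorems
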